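import Summits.QuantumFields.YangMills.Theorems.BalabanUVNodesN22NestedPolymersLimit

/-!
# THE NESTED-POLYMERS TOWER — ★★★ NODE U3's KERNEL SLOTS (N22 `N22At`, N18 `N18At`, (D4) `KernelDecay`) AT def-W1's `localizedSum` OF A GENUINE `ClusterTower` WHOSE
# ACTIVITIES READ THE COUPLINGS (A6 lane, dag-n22-w3)

Cell `pub-ymgap`, Track A (HUMAN RULING D-0062), WIDTH SEAT `dag-n22-w3` g5 on node n22 = NE9, A6-residue lane; `--kind proof --supports stmt-QuantumFields-27366 --as helper` (KEY MAP v2: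
K3⁸), COUNT-NEUTRAL; THEOREMS ONLY (0 `def`, 0 `sorry`, standard axioms).  Sequel of `…N22NestedPolymersLimit` (this seat): there W1-19b's (1.21)-existence letter holds at
`localizedSum F (nestedTower F M a) (originReading F)` by the hard schema; here the SECOND input of this seat's g2 (1.21) PASSAGE `ne9_EA_of_windowed` (p593053) — the windowed joint
history-Lipschitz bounds — is PRODUCED as well, so NE9 of W1-19's kernel functional and the N22 slot `N22At` at the kernel objects hold at def-W1's ACTUAL (1.7)∕(2.13) objects for a
tower that reads both the probe and the couplings.

* ★★ `windowedNE9_localizedSum_nestedTower` — amplitudes history-Lipschitz with SUMMABLE moduli `|a k i h − a k i h'| ≤ q^i·Σ_l Λ₀ (k+1) l |h_l − h'_l|` give, eventually in the volume,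
  `|Π^{(K)}(g) − Π^{(K)}(g')| ≤ e^{−κ|z|₁} Σ_{i ≤ k} (1−q)⁻¹ Λ₀ (k+1) i |g_i − g'_i|` (closed form `[br]·ψ(Σ a)` of `…Limit` + `|ψ(A) − ψ(B)| ≤ |A − B|` + `Σ q^i ≤ (1−q)⁻¹`).
* ★★★ `ne9_EA_localizedSum_nestedTower` — `NE9 (EA F (localizedSum F (nestedTower F M a) (originReading F)) id 𝟙) W κ ((1−q)⁻¹ Λ₀)` by g2's `ne9_EA_of_windowed` with BOTH inputs produced.
* ★★★ `n22At_localizedSum_nestedTower` — `N22At (u3OfRecord₁₃ θ (objects F (localizedSum F (nestedTower F M a) (originReading F)) id 𝟙 ⟨κ, ω, 0, (1−q)⁻¹, ω, 0, ω⟩) k)` for EVERY Stage-13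
  tuple `θ` and run length `k` (fading moduli `ω^{n−i}`), by g2's `n22At_u3OfRecord₁₃_objects_of_ne9`.
* §2 `summable_amplitudes`, ★ `tendsto_polWindow_localizedSum_nestedTower`, ★★ `kernelA_localizedSum_nestedTower` — W1-19's LIMITING (1.21) kernel of def-W1's localized sum of the
  tower IN CLOSED FORM: `kernelA g k μ ν z = [μ = ν = 0][z = 0] · ψ(Σ_i a k i (g_0, …, g_k))` (def-B's total `polLimit` IS this number; the partial sums tend to the series, `ψ` is continuous).
* §3 `psi_le_quarter`, ★ `kernelDecay_localizedSum_nestedTower` (W1-19's (D4) slot `KernelDecay … W μ ν κ` at EVERY rate: the limiting kernel vanishes off the origin entry and is `≤ 1∕4`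
  there), ★ `kernelStepRate_localizedSum_nestedTower` (W1-19b's N18 letter from a TWO-RUN letter on the amplitude series `|Σ_i a (k+1) i (b, h) − Σ_i a k i h| ≤ C₅ ϑ^{k+1}`), ★★★
  `n18At_localizedSum_nestedTower` (dag-n18-w1's `n18At_u3OfRecord₁₃_objects_iff_kernelStepRate_letter`), ★ `historyAmplitudes_twoRun` (the coupling-reading amplitude meets the two-run
  letter with `C₅ = |γ|ω`, `ϑ = ω` by dag-n18-w2's `fadingAmp_succ`) — so with ONE letter block `⟨κ, ω, |γ|ω, (1−q)⁻¹, ω, 0, ω⟩` node U3's THREE kernel inputs hold at ONE genuine tower.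
* ★ `historyAmplitudes_admissible` — the COUPLING-READING amplitude `a k i h := (1 − q) q^i ∕ 4 · (1 + clamp (fadingAmp ω k h))` (dag-n18-w2's fading amplitude, clamped to `[0, 1]`)
  meets EVERY hypothesis used in `…Limit` and here (positivity, geometric tail, partial sums `≤ 1`, Lipschitz moduli `q^i ω^{k+1−l}`) and distinguishes box histories — the whole chain is
  non-vacuous for a tower reading the couplings.

HONEST FRAMING (binding).  A MODEL-LEVEL A6 witness (test activities on def-T's catalogue, scalar probe algebra `𝔄 = ℝ`, `ρ = id`, one colour; the activities read the probe
configuration at ONE bond, with real amplitudes reading the young couplings): NOT Bałaban's activities (2.9)–(2.11), NOT the towers OF RECORD, NOT a reading OF RECORD; inhabits NO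
letter OF RECORD (`…OfRecord₁₃` read `θ`'s own term data); nothing of Bałaban's asserted or constructed; (1.21) ∕ NE9 for the terms OF RECORD NOT proved; NE9 is NOT IN PRINT for d = 4;
N22 NOT discharged; K3⁸ `SpineGivenEndpointR13SepCoPHV` OPEN, not claimed, no stub touched; counts UNMOVED (typed 28∕28 · discharged 5∕27; the chair's single count line is the only
count); one finite 𝕋⁴ programme at fixed ε — R4 closes the CONDITIONAL rung `BalabanLadder.UV` only; NOTHING about the continuum limit, ℝ⁴, OS axioms or a mass gap is proved or claimed;
the Yang–Mills mass gap (Clay) is NOT proved by any of this.  No cite tags (Summit side); TYPES only: [I] = [Balaban1987RG1] CMP **109** (1987) (1.18) p. 263, (1.20)–(1.21) p. 264;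
[II] = [Balaban1988RG2Cluster] CMP **116** (1988) (2.9)–(2.14) pp. 14–15.
-/

noncomputable section

open Finset Filter Topology
open scoped BigOperators

namespace YMDAG.N22.AtKernels.NestedPolymers

open Literature.Probability.LatticeModels
open Literature.MathematicalPhysics.QuantumFieldTheory.Balaban1983to89
open Literature.MathematicalPhysics.QuantumFieldTheory.Balaban1983to89.T4ActivityRecursionWitness (one_add_mul_mem_slitPlane isCompatible_singleton)
open Literature.MathematicalPhysics.QuantumFieldTheory.Balaban1983to89.B13Resummation (locE)
open Literature.MathematicalPhysics.QuantumFieldTheory.Balaban1983to89.B13FamilySum (coveringFamilies mem_coveringFamilies)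
open Literature.MathematicalPhysics.QuantumFieldTheory.Balaban1983to89.TreeLengthTorus (TPt TAdj TStepIn TLinked TFaceConnected IsTDom TDom tsys
  tadj_update_add_one)
open Literature.MathematicalPhysics.QuantumFieldTheory.Balaban1983to89.TreeLengthTorusGeometry (TTouch ttouch_symm tgeometry)
open Literature.MathematicalPhysics.QuantumFieldTheory.Balaban1983to89.T4Continuum (T4Family)
open Literature.MathematicalPhysics.QuantumFieldTheory.Balaban1983to89.Node00 (siteOfInt polScalar polWindow polLimit PolLimitExists TermFamily1)
open Literature.MathematicalPhysics.QuantumFieldTheory.Balaban1983to89.Node00.Sect2 (domSys domCount CPair)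
open Literature.MathematicalPhysics.QuantumFieldTheory.Balaban1983to89.B14.Eq213MaximalDomains (side)
open Literature.MathematicalPhysics.QuantumFieldTheory.Balaban1983to89.Node00.W1 (ClusterStep ClusterTower)
open Literature.MathematicalPhysics.QuantumFieldTheory.Balaban1983to89.Node00.LocalizedSum17 (localizedSum ReadingMaps)
open Literature.MathematicalPhysics.QuantumFieldTheory.Balaban1983to89.Node00.U3KernelLetters (PolLimitsExist)
open Literature.MathematicalPhysics.QuantumFieldTheory.Balaban1983to89.Node00.U3OfKernels (histPrefix)
open YMDAG.N18.FiniteVolumeLettersModel (bondEval bondEval_apply siteOfInt_eventually_ne)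
open YMDAG.N22.AtKernels.NestedTermsModel (exists_threshold_siteOfInt)
open Literature.MathematicalPhysics.QuantumFieldTheory.Balaban1983to89.B12PolarizationTensor120 (polTensor polComp expChart)

/-! ## §1 The windowed NE9 bound, NE9 and `N22At` at def-W1's `localizedSum` of the nested tower; a coupling-reading admissible amplitude -/

section History

open Literature.MathematicalPhysics.QuantumFieldTheory.Balaban1983to89.T4OutputRate (Window NE9)
open Literature.MathematicalPhysics.QuantumFieldTheory.Balaban1983to89.Node00 (Stage13Params U3Letters₁₁)
open Literature.MathematicalPhysics.QuantumFieldTheory.Balaban1983to89.Node00.U3OfKernels (EA objects)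
open Literature.MathematicalPhysics.QuantumFieldTheory.Balaban1983to89.B12Sec2to5 (l1)
open YMDAG.UVSplit (N22At u3OfRecord₁₃)
open YMDAG.N22.AtKernels (ne9_EA_of_windowed n22At_u3OfRecord₁₃_objects_of_ne9)
open YMDAG.N22.AtKernels.NestedTermsModel (eventually_siteOfInt_eq_iff)
open YMDAG.N18.FiniteVolumeLettersModel (fadingAmp fadingAmp_zero abs_fadingAmp_sub_le)

variable (F : T4Family) (M : ℕ)

/-- ★★ **THE WINDOWED JOINT HISTORY-LIPSCHITZ BOUND FOR def-W1's LOCALIZED SUM OF THE NESTED TOWER** (eventually in the volume, every rate `κ`): if the amplitudes are history-Lipschitz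
with SUMMABLE moduli `|a k i h − a k i h'| ≤ q^i · Σ_l Λ₀ (k+1) l |h_l − h'_l|` (`0 ≤ q < 1`, `Λ₀ ≥ 0`), the windowed kernels at two coupling sequences differ by at most
`e^{−κ|z|₁} Σ_{i ≤ k} (1−q)⁻¹ Λ₀ (k+1) i |g_i − g'_i|` — by the closed form `[br]·ψ(Σ_{i ≤ cap} a k i ·)` and `|ψ(A) − ψ(B)| ≤ |A − B|`. -/
theorem windowedNE9_localizedSum_nestedTower {a : (k : ℕ) → ℕ → (Fin (k + 1) → ℝ) → ℝ} (ha : ∀ k i g, 0 ≤ a k i g) {q : ℝ} (hq0 : 0 ≤ q) (hq1 : q < 1)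
    (Λ₀ : ℕ → ℕ → ℝ) (hΛ₀ : ∀ n l, 0 ≤ Λ₀ n l)
    (hlip : ∀ (k : ℕ) (h h' : Fin (k + 1) → ℝ) (i : ℕ), |a k i h - a k i h'| ≤ q ^ i * ∑ l : Fin (k + 1), Λ₀ (k + 1) l * |h l - h' l|)
    (W : Set (ℕ → ℝ)) (κ : ℝ) :
    ∀ g ∈ W, ∀ g' ∈ W, ∀ (k : ℕ) (μ ν : Fin 4) (z : Fin 4 → ℤ), ∀ᶠ K in atTop,
      |polWindow F K (k + 1) (localizedSum F (nestedTower F M a) (originReading F) k (histPrefix g k) K) (ContinuousLinearMap.id ℝ ℝ)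
            (Module.Basis.singleton Unit ℝ) μ ν z -
          polWindow F K (k + 1) (localizedSum F (nestedTower F M a) (originReading F) k (histPrefix g' k) K) (ContinuousLinearMap.id ℝ ℝ)
            (Module.Basis.singleton Unit ℝ) μ ν z| ≤
        Real.exp (-(κ * l1 z)) * ∑ i ∈ Finset.range (k + 1), (1 - q)⁻¹ * Λ₀ (k + 1) i * |g i - g' i| := by
  intro g _ g' _ k μ ν z
  filter_upwards [eventually_siteOfInt_eq_iff F (k + 1) z] with K hK
  set m := min K (domCount (F.P K) M (k + 1) - 1) with hm
  have hS0 : 0 ≤ ∑ i ∈ Finset.range (k + 1), (1 - q)⁻¹ * Λ₀ (k + 1) i * |g i - g' i| :=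
    Finset.sum_nonneg fun i _ => mul_nonneg (mul_nonneg (inv_nonneg.2 (sub_nonneg.2 hq1.le)) (hΛ₀ _ _)) (abs_nonneg _)
  rw [polWindow_localizedSum_nestedTower F M ha, polWindow_localizedSum_nestedTower F M ha]
  by_cases hbr : μ = 0 ∧ ν = 0 ∧ siteOfInt F K (k + 1) z = siteOfInt F K (k + 1) 0
  · rw [if_pos hbr, if_pos hbr]
    obtain ⟨-, -, hz⟩ := hbr
    have hz0 : z = 0 := hK.1 hz
    have hl1 : l1 z = 0 := by subst hz0; simp [l1]
    rw [hl1, mul_zero, neg_zero, Real.exp_zero, one_mul]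
    set S : ℝ := ∑ l : Fin (k + 1), Λ₀ (k + 1) l * |histPrefix g k l - histPrefix g' k l| with hS
    have hSnn : 0 ≤ S := Finset.sum_nonneg fun l _ => mul_nonneg (hΛ₀ _ _) (abs_nonneg _)
    have hSeq : ∑ i ∈ Finset.range (k + 1), (1 - q)⁻¹ * Λ₀ (k + 1) i * |g i - g' i| = (1 - q)⁻¹ * S := by
      rw [hS, Finset.mul_sum]
      simp only [Node00.U3OfKernels.histPrefix_apply]
      rw [Fin.sum_univ_eq_sum_range (fun i => (1 - q)⁻¹ * (Λ₀ (k + 1) i * |g i - g' i|)) (k + 1)]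
      exact Finset.sum_congr rfl fun i _ => by ring
    rw [hSeq]
    calc |(∑ i ∈ Finset.range (m + 1), a k i (histPrefix g k)) / (1 + ∑ i ∈ Finset.range (m + 1), a k i (histPrefix g k)) ^ 2 -
            (∑ i ∈ Finset.range (m + 1), a k i (histPrefix g' k)) / (1 + ∑ i ∈ Finset.range (m + 1), a k i (histPrefix g' k)) ^ 2|
        ≤ |∑ i ∈ Finset.range (m + 1), a k i (histPrefix g k) - ∑ i ∈ Finset.range (m + 1), a k i (histPrefix g' k)| :=
          abs_psi_sub_psi_le (Finset.sum_nonneg fun i _ => ha _ _ _) (Finset.sum_nonneg fun i _ => ha _ _ _)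
      _ ≤ ∑ i ∈ Finset.range (m + 1), |a k i (histPrefix g k) - a k i (histPrefix g' k)| := by
          rw [← Finset.sum_sub_distrib]; exact Finset.abs_sum_le_sum_abs _ _
      _ ≤ ∑ i ∈ Finset.range (m + 1), q ^ i * S := Finset.sum_le_sum fun i _ => hlip k _ _ i
      _ = (∑ i ∈ Finset.range (m + 1), q ^ i) * S := (Finset.sum_mul _ _ _).symm
      _ ≤ (1 - q)⁻¹ * S := mul_le_mul_of_nonneg_right (sum_le_hasSum _ (fun i _ => pow_nonneg hq0 i) (hasSum_geometric_of_lt_one hq0 hq1)) hSnn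
  · rw [if_neg hbr, if_neg hbr, sub_self, abs_zero]
    exact mul_nonneg (Real.exp_nonneg _) hS0

/-- ★★★ **NE9 OF W1-19's KERNEL FUNCTIONAL AT def-W1's `localizedSum` OF THE NESTED TOWER** — dag-n22-w3 g2's `ne9_EA_of_windowed` (p593053: (1.21) existence along the window +
windowed joint history-Lipschitz bounds ⇒ NE9 of `EA`) with BOTH inputs PRODUCED: existence by §2's `polLimitsExist_localizedSum_nestedTower` (the hard schema at a genuine tower),
the windowed bound by `windowedNE9_localizedSum_nestedTower`.  Moduli `(1−q)⁻¹ Λ₀`.  MODEL LEVEL. -/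
theorem ne9_EA_localizedSum_nestedTower [NeZero M] {a : (k : ℕ) → ℕ → (Fin (k + 1) → ℝ) → ℝ} (ha : ∀ k i g, 0 ≤ a k i g) {r C q : ℝ} (hr : r < 1) (hr₀ : 0 ≤ r)
    (htail : ∀ k (g : Fin (k + 1) → ℝ) i, a k (i + 1) g ≤ C * r ^ i) (hq0 : 0 ≤ q) (hq1 : q < 1) (Λ₀ : ℕ → ℕ → ℝ) (hΛ₀ : ∀ n l, 0 ≤ Λ₀ n l)
    (hlip : ∀ (k : ℕ) (h h' : Fin (k + 1) → ℝ) (i : ℕ), |a k i h - a k i h'| ≤ q ^ i * ∑ l : Fin (k + 1), Λ₀ (k + 1) l * |h l - h' l|)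
    (W : Set (ℕ → ℝ)) (κ : ℝ) :
    NE9 (EA F (localizedSum F (nestedTower F M a) (originReading F)) (ContinuousLinearMap.id ℝ ℝ) (Module.Basis.singleton Unit ℝ)) W κ
      (fun n i => (1 - q)⁻¹ * Λ₀ n i) :=
  ne9_EA_of_windowed F (localizedSum F (nestedTower F M a) (originReading F)) (ContinuousLinearMap.id ℝ ℝ) (Module.Basis.singleton Unit ℝ)
    (polLimitsExist_localizedSum_nestedTower F M ha hr hr₀ htail W) (windowedNE9_localizedSum_nestedTower F M ha hq0 hq1 Λ₀ hΛ₀ hlip W κ)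

variable {N : ℕ} [NeZero N]

/-- ★★★ **THE N22 SLOT `N22At` AT THE KERNEL OBJECTS OF def-W1's `localizedSum` OF THE NESTED TOWER**, for EVERY Stage-13 tuple `θ` and run length `k`, with the letter block
`⟨κ, ω, 0, (1−q)⁻¹, ω, 0, ω⟩` (`0 ≤ κ`, `0 < ω < 1`, fading moduli `Λ₀ n i = ω^{n−i}`) — dag-n22-w3 g2's `n22At_u3OfRecord₁₃_objects_of_ne9` on `ne9_EA_localizedSum_nestedTower`: the N22
slot met, NON-DEGENERATELY and at the tree's ACTUAL (1.7)∕(2.13) objects, by a tower whose activities read the probe and the couplings.  MODEL LEVEL; no object of record. -/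
theorem n22At_localizedSum_nestedTower [NeZero M] {a : (k : ℕ) → ℕ → (Fin (k + 1) → ℝ) → ℝ} (ha : ∀ k i g, 0 ≤ a k i g) {r C q κ ω : ℝ} (hr : r < 1) (hr₀ : 0 ≤ r)
    (htail : ∀ k (g : Fin (k + 1) → ℝ) i, a k (i + 1) g ≤ C * r ^ i) (hq0 : 0 ≤ q) (hq1 : q < 1) (hκ : 0 ≤ κ) (hω : 0 < ω) (hω1 : ω < 1)
    (hlip : ∀ (k : ℕ) (h h' : Fin (k + 1) → ℝ) (i : ℕ), |a k i h - a k i h'| ≤ q ^ i * ∑ l : Fin (k + 1), ω ^ (k + 1 - (l : ℕ)) * |h l - h' l|)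
    (θ : Stage13Params F N) (k : ℕ) :
    N22At (u3OfRecord₁₃ θ (objects F (localizedSum F (nestedTower F M a) (originReading F)) (ContinuousLinearMap.id ℝ ℝ) (Module.Basis.singleton Unit ℝ)
      ⟨κ, ω, 0, (1 - q)⁻¹, ω, 0, ω⟩) k) :=
  n22At_u3OfRecord₁₃_objects_of_ne9 F (localizedSum F (nestedTower F M a) (originReading F)) (ContinuousLinearMap.id ℝ ℝ) (Module.Basis.singleton Unit ℝ) θ _
    ⟨hκ, hω, hω1, le_rfl, inv_nonneg.2 (sub_nonneg.2 hq1.le), hω.le, hω1, le_rfl, le_rfl, le_rfl, hω1⟩ k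
    (ne9_EA_localizedSum_nestedTower F M ha hr hr₀ htail hq0 hq1 (fun n i => ω ^ (n - i)) (fun _ _ => pow_nonneg hω.le _) hlip (Window θ.γ) κ)


/-- ★ **A COUPLING-READING ADMISSIBLE AMPLITUDE**: `a k i h := (1 − q) q^i ∕ 4 · (1 + clamp (fadingAmp ω k h))`, `clamp x = max (min x 1) 0` (dag-n18-w2's fading amplitude
`Σ_{l ≤ k} ω^{k+1−l} h_l`, clamped to `[0, 1]`): POSITIVE, geometric tail `≤ 1 · q^i`, partial sums `≤ 1`, and history-Lipschitz with the summable moduli `q^i · ω^{k+1−l}` — so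
`polLimitsExist_localizedSum_nestedTower`, `ne9_EA_localizedSum_nestedTower`, `n22At_localizedSum_nestedTower` and the non-degeneracy certificates ALL apply to it (`0 < q < 1`,
`0 ≤ ω`); and it READS THE COUPLINGS (last clause: at level `0` the box histories `(γ)`, `(γ∕2)` with `0 < ωγ ≤ 1` get different amplitudes). -/
theorem historyAmplitudes_admissible {q ω : ℝ} (hq0 : 0 < q) (hq1 : q < 1) (hω : 0 ≤ ω) :
    (∀ (k i : ℕ) (h : Fin (k + 1) → ℝ), 0 < (1 - q) * q ^ i / 4 * (1 + max (min (fadingAmp ω k h) 1) 0)) ∧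
    (∀ (k : ℕ) (h : Fin (k + 1) → ℝ) (i : ℕ), (1 - q) * q ^ (i + 1) / 4 * (1 + max (min (fadingAmp ω k h) 1) 0) ≤ 1 * q ^ i) ∧
    (∀ (k : ℕ) (h : Fin (k + 1) → ℝ) (j : ℕ), ∑ i ∈ Finset.range j, (1 - q) * q ^ i / 4 * (1 + max (min (fadingAmp ω k h) 1) 0) ≤ 1) ∧
    (∀ (k : ℕ) (h h' : Fin (k + 1) → ℝ) (i : ℕ),
      |(1 - q) * q ^ i / 4 * (1 + max (min (fadingAmp ω k h) 1) 0) - (1 - q) * q ^ i / 4 * (1 + max (min (fadingAmp ω k h') 1) 0)| ≤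
        q ^ i * ∑ l : Fin (k + 1), ω ^ (k + 1 - (l : ℕ)) * |h l - h' l|) ∧
    (∀ γ : ℝ, 0 < ω * γ → ω * γ ≤ 1 →
      (1 - q) * q ^ 0 / 4 * (1 + max (min (fadingAmp ω 0 fun _ => γ) 1) 0) ≠ (1 - q) * q ^ 0 / 4 * (1 + max (min (fadingAmp ω 0 fun _ => γ / 2) 1) 0)) := by
  have hc0 : ∀ x : ℝ, 0 ≤ max (min x 1) 0 := fun x => le_max_right _ _
  have hc1 : ∀ x : ℝ, max (min x 1) 0 ≤ 1 := fun x => max_le (min_le_right _ _) zero_le_one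
  have hclip : ∀ x y : ℝ, |max (min x 1) 0 - max (min y 1) 0| ≤ |x - y| := fun x y =>
    (abs_max_sub_max_le_abs _ _ _).trans ((abs_min_sub_min_le_max x 1 y 1).trans (by rw [sub_self, abs_zero, max_eq_left (abs_nonneg _)]))
  have hq1' : 0 < 1 - q := sub_pos.2 hq1
  refine ⟨fun k i h => ?_, fun k h i => ?_, fun k h j => ?_, fun k h h' i => ?_, fun γ hωγ hωγ1 => ?_⟩
  · have := pow_pos hq0 i
    have := hc0 (fadingAmp ω k h)
    positivity
  · have hqi := pow_pos hq0 i
    have h2 : 1 + max (min (fadingAmp ω k h) 1) 0 ≤ 2 := by linarith [hc1 (fadingAmp ω k h)]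
    calc (1 - q) * q ^ (i + 1) / 4 * (1 + max (min (fadingAmp ω k h) 1) 0) ≤ (1 - q) * q ^ (i + 1) / 4 * 2 :=
          mul_le_mul_of_nonneg_left h2 (by positivity)
      _ = q ^ i * ((1 - q) * q / 2) := by ring
      _ ≤ q ^ i * 1 := mul_le_mul_of_nonneg_left (by nlinarith) hqi.le
      _ = 1 * q ^ i := by ring
  · have h2 : 1 + max (min (fadingAmp ω k h) 1) 0 ≤ 2 := by linarith [hc1 (fadingAmp ω k h)]
    have hgeom : ∑ i ∈ Finset.range j, q ^ i ≤ (1 - q)⁻¹ := sum_le_hasSum _ (fun i _ => (pow_pos hq0 i).le) (hasSum_geometric_of_lt_one hq0.le hq1)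
    calc ∑ i ∈ Finset.range j, (1 - q) * q ^ i / 4 * (1 + max (min (fadingAmp ω k h) 1) 0)
        ≤ ∑ i ∈ Finset.range j, (1 - q) * q ^ i / 4 * 2 := Finset.sum_le_sum fun i _ =>
          mul_le_mul_of_nonneg_left h2 (by have := pow_pos hq0 i; positivity)
      _ = (1 - q) / 2 * ∑ i ∈ Finset.range j, q ^ i := by rw [Finset.mul_sum]; exact Finset.sum_congr rfl fun i _ => by ring
      _ ≤ (1 - q) / 2 * (1 - q)⁻¹ := mul_le_mul_of_nonneg_left hgeom (by positivity)
      _ = 1 / 2 := by field_simp [hq1'.ne']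
      _ ≤ 1 := by norm_num
  · rw [← mul_sub, abs_mul, abs_of_pos (by have := pow_pos hq0 i; positivity), add_sub_add_left_eq_sub]
    calc (1 - q) * q ^ i / 4 * |max (min (fadingAmp ω k h) 1) 0 - max (min (fadingAmp ω k h') 1) 0|
        ≤ (1 - q) * q ^ i / 4 * ∑ l : Fin (k + 1), ω ^ (k + 1 - (l : ℕ)) * |h l - h' l| :=
          mul_le_mul_of_nonneg_left ((hclip _ _).trans (abs_fadingAmp_sub_le hω k h h'))
            (by have := pow_pos hq0 i; positivity)
      _ ≤ q ^ i * ∑ l : Fin (k + 1), ω ^ (k + 1 - (l : ℕ)) * |h l - h' l| := by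
          have hS : 0 ≤ ∑ l : Fin (k + 1), ω ^ (k + 1 - (l : ℕ)) * |h l - h' l| := Finset.sum_nonneg fun l _ => mul_nonneg (pow_nonneg hω _) (abs_nonneg _)
          have hqi := pow_pos hq0 i
          exact mul_le_mul_of_nonneg_right (by nlinarith) hS
  · rw [fadingAmp_zero, fadingAmp_zero]
    have e1 : max (min (ω * γ) 1) 0 = ω * γ := by rw [min_eq_left hωγ1, max_eq_left hωγ.le]
    have e2 : max (min (ω * (γ / 2)) 1) 0 = ω * (γ / 2) := by
      rw [min_eq_left (by nlinarith), max_eq_left (by nlinarith)]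
    rw [e1, e2]
    intro h
    have hq : (1 - q) * q ^ 0 / 4 ≠ 0 := by positivity
    have := mul_left_cancel₀ hq h
    nlinarith

end History


/-! ## §2 The (1.21) LIMIT of the nested tower's kernels in closed form: `[μ = ν = 0][z = 0] · ψ(Σ_i a k i (g_0, …, g_k))` -/

section Limit

open Literature.MathematicalPhysics.QuantumFieldTheory.Balaban1983to89.Node00.U3OfKernels (kernelA)
open YMDAG.N22.AtKernels.NestedTermsModel (eventually_siteOfInt_eq_iff)

variable (F : T4Family) (M : ℕ) [NeZero M]

/-- The amplitudes at a history are SUMMABLE (nonnegative with a geometric tail). -/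
theorem summable_amplitudes {a : (k : ℕ) → ℕ → (Fin (k + 1) → ℝ) → ℝ} (ha : ∀ k i g, 0 ≤ a k i g) {r C : ℝ} (hr : r < 1) (hr₀ : 0 ≤ r)
    (htail : ∀ k (g : Fin (k + 1) → ℝ) i, a k (i + 1) g ≤ C * r ^ i) (k : ℕ) (g : Fin (k + 1) → ℝ) : Summable fun i => a k i g := by
  refine (summable_nat_add_iff 1).1 (Summable.of_nonneg_of_le (fun i => ha k _ g) (fun i => htail k g i) ?_)
  exact (summable_geometric_of_lt_one hr₀ hr).mul_left C

/-- ★ **THE WINDOWED KERNELS OF def-W1's LOCALIZED SUM OF THE NESTED TOWER CONVERGE** to `[μ = ν = 0][z = 0] · ψ(Σ_i a k i (g_0, …, g_k))` (`ψ(A) = A∕(1+A)²`): beyond the volume threshold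
the cap is `K`, beyond the window threshold the bracket reads `ℤ⁴` faithfully, the partial sums tend to the series and `ψ` is continuous. -/
theorem tendsto_polWindow_localizedSum_nestedTower {a : (k : ℕ) → ℕ → (Fin (k + 1) → ℝ) → ℝ} (ha : ∀ k i g, 0 ≤ a k i g) {r C : ℝ} (hr : r < 1) (hr₀ : 0 ≤ r)
    (htail : ∀ k (g : Fin (k + 1) → ℝ) i, a k (i + 1) g ≤ C * r ^ i) (k : ℕ) (hist : Fin (k + 1) → ℝ) (μ ν : Fin 4) (z : Fin 4 → ℤ) :
    Tendsto (fun K : ℕ => polWindow F K (k + 1) (localizedSum F (nestedTower F M a) (originReading F) k hist K) (ContinuousLinearMap.id ℝ ℝ)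
        (Module.Basis.singleton Unit ℝ) μ ν z) atTop
      (nhds (if μ = 0 ∧ ν = 0 ∧ z = 0 then (∑' i, a k i hist) / (1 + ∑' i, a k i hist) ^ 2 else 0)) := by
  obtain ⟨K₁, hK₁⟩ := exists_threshold_domCount (F := F) (M := M) k
  have hsum := summable_amplitudes ha hr hr₀ htail k hist
  have hA0 : 0 ≤ ∑' i, a k i hist := tsum_nonneg fun i => ha k i hist
  -- the partial sums over `range (cap + 1)`, beyond the threshold `range (K + 1)`, tend to the series; `ψ` is continuous there
  have hps : Tendsto (fun K : ℕ => ∑ i ∈ Finset.range (min K (domCount (F.P K) M (k + 1) - 1) + 1), a k i hist) atTop (nhds (∑' i, a k i hist)) := by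
    refine ((hsum.hasSum.tendsto_sum_nat).comp (tendsto_add_atTop_nat 1)).congr' ?_
    filter_upwards [eventually_ge_atTop K₁] with K hK
    have hcap : min K (domCount (F.P K) M (k + 1) - 1) = K := by have := hK₁ K hK; omega
    show ∑ i ∈ Finset.range (K + 1), a k i hist = ∑ i ∈ Finset.range (min K (domCount (F.P K) M (k + 1) - 1) + 1), a k i hist
    rw [hcap]
  have hψ : ContinuousAt (fun A : ℝ => A / (1 + A) ^ 2) (∑' i, a k i hist) :=
    (continuousAt_id.div ((continuousAt_const.add continuousAt_id).pow 2) (by positivity))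
  have hlim : Tendsto (fun K : ℕ => (∑ i ∈ Finset.range (min K (domCount (F.P K) M (k + 1) - 1) + 1), a k i hist) /
      (1 + ∑ i ∈ Finset.range (min K (domCount (F.P K) M (k + 1) - 1) + 1), a k i hist) ^ 2) atTop
      (nhds ((∑' i, a k i hist) / (1 + ∑' i, a k i hist) ^ 2)) := hψ.tendsto.comp hps
  by_cases hP : μ = 0 ∧ ν = 0 ∧ z = 0
  · rw [if_pos hP]
    obtain ⟨hμ, hν, hz⟩ := hP
    refine hlim.congr' (Eventually.of_forall fun K => ?_)
    beta_reduce
    rw [polWindow_localizedSum_nestedTower F M ha, if_pos ⟨hμ, hν, by rw [hz]⟩]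
  · rw [if_neg hP]
    refine tendsto_const_nhds.congr' ?_
    filter_upwards [eventually_siteOfInt_eq_iff F (k + 1) z] with K hK
    rw [polWindow_localizedSum_nestedTower F M ha, if_neg (fun h' => hP ⟨h'.1, h'.2.1, hK.1 h'.2.2⟩)]

/-- ★★ **W1-19's LIMITING (1.21) KERNEL OF def-W1's LOCALIZED SUM OF THE NESTED TOWER, IN CLOSED FORM**: `kernelA g k μ ν z = [μ = ν = 0][z = 0] · ψ(Σ_i a k i (g_0, …, g_k))` —
def-B's TOTAL `polLimit` (a `limUnder`) IS this number; non-zero at the origin entry as soon as one amplitude is, and reading every young coupling the amplitudes read. -/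
theorem kernelA_localizedSum_nestedTower {a : (k : ℕ) → ℕ → (Fin (k + 1) → ℝ) → ℝ} (ha : ∀ k i g, 0 ≤ a k i g) {r C : ℝ} (hr : r < 1) (hr₀ : 0 ≤ r)
    (htail : ∀ k (g : Fin (k + 1) → ℝ) i, a k (i + 1) g ≤ C * r ^ i) (g : ℕ → ℝ) (k : ℕ) (μ ν : Fin 4) (z : Fin 4 → ℤ) :
    kernelA F (localizedSum F (nestedTower F M a) (originReading F)) (ContinuousLinearMap.id ℝ ℝ) (Module.Basis.singleton Unit ℝ) g k μ ν z =
      if μ = 0 ∧ ν = 0 ∧ z = 0 then (∑' i, a k i (histPrefix g k)) / (1 + ∑' i, a k i (histPrefix g k)) ^ 2 else 0 :=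
  (tendsto_polWindow_localizedSum_nestedTower F M ha hr hr₀ htail k (histPrefix g k) μ ν z).limUnder_eq

end Limit


/-! ## §3 NODE U3's THREE KERNEL SLOTS AT THE NESTED TOWER: (D4) `KernelDecay`, N18 `KernelStepRate` ∕ `N18At`, with the N22 block -/

section U3

open Literature.MathematicalPhysics.QuantumFieldTheory.Balaban1983to89.T4OutputRate (Window)
open Literature.MathematicalPhysics.QuantumFieldTheory.Balaban1983to89.Node00 (Stage13Params U3Letters₁₁ prependCoupling)
open Literature.MathematicalPhysics.QuantumFieldTheory.Balaban1983to89.Node00.U3OfKernels (kernelA objects KernelDecay histPrefix_prependCoupling)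
open Literature.MathematicalPhysics.QuantumFieldTheory.Balaban1983to89.Node00.U3KernelLetters (KernelStepRate)
open Literature.MathematicalPhysics.QuantumFieldTheory.Balaban1983to89.B12Sec2to5 (l1 Decay510)
open YMDAG.UVSplit (N18At u3OfRecord₁₃)
open YMDAG.N18.FiniteVolumeLettersModel (fadingAmp fadingAmp_succ)

variable (F : T4Family) (M : ℕ) [NeZero M]

/-- `ψ(A) = A∕(1+A)² ≤ 1∕4` for `A ≥ 0`. -/
theorem psi_le_quarter {A : ℝ} (hA : 0 ≤ A) : A / (1 + A) ^ 2 ≤ 1 / 4 := by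
  rw [div_le_div_iff₀ (by positivity) (by norm_num)]
  nlinarith [sq_nonneg (A - 1)]

/-- ★ **THE (D4) KERNEL SLOT AT THE NESTED TOWER, EVERY RATE `κ`**: W1-19's `KernelDecay F ℰ id 𝟙 W μ ν κ` for the localized sum of the tower — the limiting kernel vanishes off the origin
entry and is `≤ 1∕4` there (`kernelA_localizedSum_nestedTower`).  MODEL LEVEL. -/
theorem kernelDecay_localizedSum_nestedTower {a : (k : ℕ) → ℕ → (Fin (k + 1) → ℝ) → ℝ} (ha : ∀ k i g, 0 ≤ a k i g) {r C : ℝ} (hr : r < 1) (hr₀ : 0 ≤ r)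
    (htail : ∀ k (g : Fin (k + 1) → ℝ) i, a k (i + 1) g ≤ C * r ^ i) (W : Set (ℕ → ℝ)) (μ ν : Fin 4) (κ : ℝ) :
    KernelDecay F (localizedSum F (nestedTower F M a) (originReading F)) (ContinuousLinearMap.id ℝ ℝ) (Module.Basis.singleton Unit ℝ) W μ ν κ := by
  intro g _
  refine ⟨1 / 4, fun k z => ?_⟩
  rw [kernelA_localizedSum_nestedTower F M ha hr hr₀ htail g k μ ν z]
  split_ifs with h
  · obtain ⟨-, -, rfl⟩ := h
    have h0 : l1 (0 : Fin 4 → ℤ) = 0 := by simp [l1]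
    rw [h0, mul_zero, Real.exp_zero, mul_one, abs_of_nonneg (div_nonneg (tsum_nonneg fun i => ha k i _) (by positivity))]
    exact psi_le_quarter (tsum_nonneg fun i => ha k i _)
  · rw [abs_zero]; positivity

/-- ★ **THE N18 KERNEL SLOT AT THE NESTED TOWER**: W1-19b's `KernelStepRate F ℰ id 𝟙 γ κ θ C₅` for the localized sum of the tower from a TWO-RUN letter ON THE AMPLITUDES — prepending an
unpaired first coupling `b ∈ ]0, γ]` and raising the level moves the amplitude series by at most `C₅ θ^{k+1}` (`|Σ_i a (k+1) i (b, h) − Σ_i a k i h| ≤ C₅ θ^{k+1}` on the boxes) —, since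
the limiting kernels are `[br]·ψ(Σ a)` and `ψ` is `1`-Lipschitz on `ℝ≥0`.  MODEL LEVEL. -/
theorem kernelStepRate_localizedSum_nestedTower {a : (k : ℕ) → ℕ → (Fin (k + 1) → ℝ) → ℝ} (ha : ∀ k i g, 0 ≤ a k i g) {r C : ℝ} (hr : r < 1) (hr₀ : 0 ≤ r)
    (htail : ∀ k (g : Fin (k + 1) → ℝ) i, a k (i + 1) g ≤ C * r ^ i) {γ κ θ C₅ : ℝ} (hC₅ : 0 ≤ C₅) (hθ : 0 ≤ θ)
    (hstep : ∀ (b : ℝ), 0 < b → b ≤ γ → ∀ g ∈ Window γ, ∀ k : ℕ,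
      |∑' i, a (k + 1) i (Fin.cons b (histPrefix g k)) - ∑' i, a k i (histPrefix g k)| ≤ C₅ * θ ^ (k + 1)) :
    KernelStepRate F (localizedSum F (nestedTower F M a) (originReading F)) (ContinuousLinearMap.id ℝ ℝ) (Module.Basis.singleton Unit ℝ) γ κ θ C₅ := by
  intro b hb hbγ g hg k μ ν z
  rw [kernelA_localizedSum_nestedTower F M ha hr hr₀ htail g k μ ν z, kernelA_localizedSum_nestedTower F M ha hr hr₀ htail (prependCoupling b g) (k + 1) μ ν z,
    histPrefix_prependCoupling]
  split_ifs with h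
  · obtain ⟨-, -, rfl⟩ := h
    have h0 : l1 (0 : Fin 4 → ℤ) = 0 := by simp [l1]
    rw [h0, mul_zero, neg_zero, Real.exp_zero, mul_one, abs_sub_comm]
    exact (abs_psi_sub_psi_le (tsum_nonneg fun i => ha _ i _) (tsum_nonneg fun i => ha k i _)).trans (hstep b hb hbγ g hg k)
  · rw [sub_self, abs_zero]; positivity

variable {N : ℕ} [NeZero N]

/-- ★★★ **THE N18 SLOT `N18At` AT THE KERNEL OBJECTS OF def-W1's `localizedSum` OF THE NESTED TOWER** (dag-n18-w1's `n18At_u3OfRecord₁₃_objects_iff_kernelStepRate_letter`), for EVERY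
Stage-13 tuple `θ` and run length, with the letter block `⟨κ, ϑ, C₅, C₉, ω, cr, ρ⟩` whose `(ϑ, C₅)` are the two-run letter's.  With `n22At_localizedSum_nestedTower` and
`kernelDecay_localizedSum_nestedTower` this puts node U3's THREE kernel inputs (N18 ∕ N22 ∕ (D4)) at ONE genuine tower of def-W1's actual objects.  MODEL LEVEL; no object of record. -/
theorem n18At_localizedSum_nestedTower {a : (k : ℕ) → ℕ → (Fin (k + 1) → ℝ) → ℝ} (ha : ∀ k i g, 0 ≤ a k i g) {r C : ℝ} (hr : r < 1) (hr₀ : 0 ≤ r)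
    (htail : ∀ k (g : Fin (k + 1) → ℝ) i, a k (i + 1) g ≤ C * r ^ i) (θ : Stage13Params F N) (ℓ : U3Letters₁₁) (hC₅ : 0 ≤ ℓ.C₅) (hθ₅ : 0 ≤ ℓ.θ₅)
    (hstep : ∀ (b : ℝ), 0 < b → b ≤ θ.γ → ∀ g ∈ Window θ.γ, ∀ k : ℕ,
      |∑' i, a (k + 1) i (Fin.cons b (histPrefix g k)) - ∑' i, a k i (histPrefix g k)| ≤ ℓ.C₅ * ℓ.θ₅ ^ (k + 1)) (k : ℕ) :
    N18At (u3OfRecord₁₃ θ (objects F (localizedSum F (nestedTower F M a) (originReading F)) (ContinuousLinearMap.id ℝ ℝ) (Module.Basis.singleton Unit ℝ) ℓ) k) :=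
  (YMDAG.N18.AtRecordOfKernelLetters.n18At_u3OfRecord₁₃_objects_iff_kernelStepRate_letter F _ _ _ θ ℓ k).2
    (kernelStepRate_localizedSum_nestedTower F M ha hr hr₀ htail hC₅ hθ₅ hstep)

/-- ★ **THE COUPLING-READING AMPLITUDE MEETS THE TWO-RUN LETTER** with `C₅ := |γ| ω`, `ϑ := ω` (`0 ≤ ω`, `0 < q < 1`): prepending `b ∈ ]0, γ]` changes dag-n18-w2's fading amplitude
by `ω^{k+2} b` (`fadingAmp_succ`), the clamp is `1`-Lipschitz, and `Σ_i (1−q)q^i∕4 ≤ 1`. -/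
theorem historyAmplitudes_twoRun {q ω γ : ℝ} (hq0 : 0 < q) (hq1 : q < 1) (hω : 0 ≤ ω) (b : ℝ) (hb : 0 < b) (hbγ : b ≤ γ) (k : ℕ) (h : Fin (k + 1) → ℝ) :
    |∑' i, (1 - q) * q ^ i / 4 * (1 + max (min (fadingAmp ω (k + 1) (Fin.cons b h)) 1) 0) - ∑' i, (1 - q) * q ^ i / 4 * (1 + max (min (fadingAmp ω k h) 1) 0)| ≤
      |γ| * ω * ω ^ (k + 1) := by
  have hclip : ∀ x y : ℝ, |max (min x 1) 0 - max (min y 1) 0| ≤ |x - y| := fun x y =>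
    (abs_max_sub_max_le_abs _ _ _).trans ((abs_min_sub_min_le_max x 1 y 1).trans (by rw [sub_self, abs_zero, max_eq_left (abs_nonneg _)]))
  have hsucc : fadingAmp ω (k + 1) (Fin.cons b h) = ω ^ (k + 2) * b + fadingAmp ω k h := by
    rw [fadingAmp_succ]; simp
  have hq1' : (1 : ℝ) - q ≠ 0 := (sub_pos.2 hq1).ne'
  have hgeo : HasSum (fun i : ℕ => (1 - q) * q ^ i / 4) (1 / 4) := by
    have h := (hasSum_geometric_of_lt_one hq0.le hq1).mul_left ((1 - q) / 4)
    have e1 : (fun i : ℕ => (1 - q) / 4 * q ^ i) = fun i => (1 - q) * q ^ i / 4 := funext fun i => by ring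
    have e2 : (1 - q) / 4 * (1 - q)⁻¹ = 1 / 4 := by field_simp
    rwa [e1, e2] at h
  have htot : ∑' i : ℕ, (1 - q) * q ^ i / 4 = 1 / 4 := hgeo.tsum_eq
  set c₁ := max (min (fadingAmp ω (k + 1) (Fin.cons b h)) 1) 0 with hc₁
  set c₀ := max (min (fadingAmp ω k h) 1) 0 with hc₀
  have hs₁ : Summable fun i : ℕ => (1 - q) * q ^ i / 4 * (1 + c₁) := hgeo.summable.mul_right _
  have hs₀ : Summable fun i : ℕ => (1 - q) * q ^ i / 4 * (1 + c₀) := hgeo.summable.mul_right _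
  rw [← hs₁.tsum_sub hs₀]
  have e : (fun i : ℕ => (1 - q) * q ^ i / 4 * (1 + c₁) - (1 - q) * q ^ i / 4 * (1 + c₀)) = fun i => (1 - q) * q ^ i / 4 * (c₁ - c₀) := by
    funext i; ring
  rw [e, tsum_mul_right, htot]
  have hcc : |c₁ - c₀| ≤ ω ^ (k + 2) * |b| := by
    refine (hclip _ _).trans ?_
    rw [hsucc, add_sub_cancel_right, abs_mul, abs_of_nonneg (pow_nonneg hω _)]
  rw [abs_mul, abs_of_pos (by norm_num : (0 : ℝ) < 1 / 4)]
  have hbabs : |b| ≤ |γ| := by rw [abs_of_pos hb]; exact hbγ.trans (le_abs_self γ)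
  calc 1 / 4 * |c₁ - c₀| ≤ 1 * (ω ^ (k + 2) * |γ|) := by
        refine mul_le_mul (by norm_num) (hcc.trans (mul_le_mul_of_nonneg_left hbabs (pow_nonneg hω _))) (abs_nonneg _) zero_le_one
    _ = |γ| * ω * ω ^ (k + 1) := by ring

end U3

end YMDAG.N22.AtKernels.NestedPolymers

end
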